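import Summits.ResolutionOfSingularities.ResolutionOfSingularities.Theorems.FrobeniusClosingPatchingRelPerfectCuspLineStep
import Summits.ResolutionOfSingularities.ResolutionOfSingularities.Theorems.FrobeniusClosingPatchingRelPerfectCoreRungTower
import HarnessLib

/-!
# Crux `PatchingRelPerfect` (stmt-ResolutionOfSingularities-16161), chain w52 — kernel (iii)
# certificate of the cusp member, part 2: the member `I = (z² + w³) + 𝔪⁴` is in the companion class

[OURS · L1 W5.2 · kernel (iii) certificate, CHAIN v1.7 §1 (C) «cusp (x₃²+x₀³)+𝔪⁴»] The simplest
NON-GRADED member of the `𝔪`-primary stratum of the open core `stub_atomDimFourBlowup` (this seat's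
hand note `NONGRADED-CUSP-MEMBER.md`, evidence #52: on `Bl_𝔪`, `I𝒪 = 𝓘_E² · K`,
`K = (z̃² + u w̃³, u²)`, graded hull `(z̃², u²) ≠ K`; `I` is not a reduction of `(z², w³) + 𝔪⁴`).
PROVED for every regular local ring `S` of ANY dimension, characteristic and residue field, and any
two distinct members `w = x_{iw}`, `z = x_{iz}` of a regular system of parameters `x`:

* `CuspMember.isRegular_of_isBlowup_member_mul_companion` — every blowing up of `Spec S` along
  `I · Q₀ · 𝔪` is regular, `Q₀ = 𝔞₁ 𝔞₂ 𝔞₃ · (J · (I + z𝔪²)) · (𝔪² + (z))`,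
  `𝔞_k = 𝔪ᵏ⁺¹ + (wᵏ) + z𝔪ᵏ⁻¹`, `J = (z², w³) + 𝔪⁴` (the S-avatars of the note: three LINE centres,
  graded hull, `I + z𝔪²`, tangency surface) — the 8-step tower `𝔪; ℓ, ℓ₂, ℓ₃; Σ̃; Euclid × 3`.
  Chartwise over `Bl_𝔪` (`isRegular_of_isBlowup_mul_of_charts`) from ONE chart-image computation
  `map_member_mul_Q₀`: `(I Q₀) B_i = u¹³ · F₃(u, z/x_i, w/x_i)`, `F₃` the line-step residual of
  part 1; `x_i ∉ {w, z}`: the LINE TOWER `lineTower_isRegular 3`; `x_i = w`: `F₃(u, c, 1)` is the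
  tangent-Euclid ideal (`tangent_euclid_two_two`); `x_i = z`: `F₃ = (1)`;
* `CuspMember.companion_member`, `CuspMember.coreRung_member`, `CuspMember.atomDimFourBlowupAt_member`
  — `I ∈ 𝒞` (W2 / r1d format, companion `Q₀ 𝔪 ⊇ 𝔪²⁰`), the conclusion of the open core for every
  `T = Bl_I Spec S` (`atomConclusion_of_pointBlowup_charts`), and the registered binder shape.

First kernel-(iii) certificate with the TANGENT finishing phenomenon (note §4 (b)); FORMAT evidence
for the core on the `𝔪`-primary stratum, nothing about standing; nothing here is a statement of the
manuscript under review.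

## References

* Q. Liu, *Algebraic Geometry and Arithmetic Curves*, OUP 2002, Thm. 8.1.19 (a). [Liu2002]
* The Stacks Project, Tags 080A, 080B, 0804, 0BIQ. [StacksProject]
* U. Görtz, T. Wedhorn, *Algebraic Geometry I* (2nd ed., 2020), Prop. 13.91 (2), 13.96 (2).
  [GortzWedhorn2020]
-/

-- `Summit.<Summit>.<Sub>.Theorems` with `Sub = Summit` (single-conjunct summit, D-0017)
set_option linter.dupNamespace false

noncomputable section

open CategoryTheory CategoryTheory.Limits AlgebraicGeometry Literature.AlgebraicGeometry.Resolution
open scoped Pointwise nonZeroDivisors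

namespace Summit.ResolutionOfSingularities.ResolutionOfSingularities.Theorems

universe u

namespace CuspMember

/-- Line avatar `(t, aʲ⁺¹, c)`. -/
local notation3 "Lf[" t "," c "," a "," j "]" =>
  (Ideal.span {t} ⊔ Ideal.span {a ^ (j + 1)} ⊔ Ideal.span {c})
/-- The residual `K_k = (c² + t aᵏ) + (t²)` of the member itself. -/
local notation3 "Kf[" t "," c "," a "," k "]" => (Ideal.span {c ^ 2 + t * a ^ k} ⊔ Ideal.span {t ^ 2})
/-- The residual of the graded-hull avatar `J`: `(c², t aᵏ, t²)`. -/
local notation3 "Jf[" t "," c "," a "," k "]" =>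
  (Ideal.span {c ^ 2} ⊔ Ideal.span {t * a ^ k} ⊔ Ideal.span {t ^ 2})
/-- The residual of the avatar `I + z𝔪²`: `(c² + t aᵏ) + (t², t c)`. -/
local notation3 "Af[" t "," c "," a "," k "]" =>
  ((Ideal.span {c ^ 2 + t * a ^ k} ⊔ Ideal.span {t ^ 2}) ⊔ Ideal.span {t * c})
/-- The tangency locus `(t, c)`. -/
local notation3 "Sf[" t "," c "]" => Ideal.span (Set.range ![t, c])
/-- The tangent-Euclid block `K · (J · A) · (t, c)`. -/
local notation3 "Tf[" t "," c "," a "," k "]" =>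
  (Kf[t,c,a,k] * (Jf[t,c,a,k] * Af[t,c,a,k]) * Sf[t,c])
/-- The full residual `F_k = ∏_{j<k} (t, aʲ⁺¹, c) · T_k`. -/
local notation3 "Ff[" t "," c "," a "," k "]" =>
  ((∏ j ∈ Finset.range k, Lf[t,c,a,j]) * Tf[t,c,a,k])

/-! ## Specialisations of the residual `F₃`: `a = 1` (chart of `w`) and `c = 1` (chart of `z`) -/

section Special

variable {A : Type u} [CommRing A]

/-- `(c², t, t²) = (t + c²) + (c²)`. [folklore] -/
theorem baseW_J (t c : A) :
    Ideal.span {c ^ 2} ⊔ Ideal.span {t} ⊔ Ideal.span {t ^ 2} = Ideal.span {t + c ^ 2} ⊔ Ideal.span {c ^ 2} := by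
  rw [← base_J t c 1, pow_zero, mul_one]

/-- **On the chart of `w` (`a = w/x_i = 1`) the residual `F₃(t, c, 1)` is the tangent-Euclid
ideal.** [folklore] -/
theorem F_three_a_one (t c : A) :
    Ff[t,c,(1 : A),3] = ((Ideal.span {t + c ^ 2} ⊔ Ideal.span {t ^ 2}) *
      ((Ideal.span {t + c ^ 2} ⊔ Ideal.span {c ^ 2}) * (Ideal.span {t + c ^ 2} ⊔ Ideal.span {c ^ 3}))) *
        Ideal.span (Set.range ![t, c]) := by
  have hL : ∀ j : ℕ, Lf[t,c,(1 : A),j] = ⊤ := fun j => by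
    rw [one_pow, Ideal.span_singleton_one, sup_top_eq, top_sup_eq]
  simp_rw [hL]
  rw [Finset.prod_const, Ideal.top_pow, Ideal.top_mul, one_pow, mul_one, add_comm (c ^ 2) t, baseW_J,
    base_A]

/-- **On the chart of `z` (`c = z/x_i = 1`) the residual `F_k(t, 1, a)` is the unit ideal.**
[folklore] -/
theorem F_c_one (t a : A) (k : ℕ) : Ff[t,(1 : A),a,k] = ⊤ := by
  have hS : Sf[t,(1 : A)] = ⊤ := by
    rw [span_range_vec2, Ideal.span_singleton_one, sup_top_eq]
  have hJ : Jf[t,(1 : A),a,k] = ⊤ := by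
    rw [one_pow, Ideal.span_singleton_one, top_sup_eq, top_sup_eq]
  have hK : Kf[t,(1 : A),a,k] = ⊤ :=
    CoreRungTower.eq_top_of_isUnit_eq_sub isUnit_one (h := (1 : A) ^ 2 + t * a ^ k) (n := t * a ^ k)
      (by ring) _ 1 2 (by rw [pow_one]; exact Ideal.mem_sup_left (Ideal.mem_span_singleton_self _))
      (Ideal.mem_sup_right (Ideal.mem_span_singleton.mpr ⟨a ^ (2 * k), by ring⟩))
  have hA : Af[t,(1 : A),a,k] = ⊤ := by rw [hK, top_sup_eq]
  have hL : ∀ j : ℕ, Lf[t,(1 : A),a,j] = ⊤ := fun j => by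
    rw [Ideal.span_singleton_one, sup_top_eq]
  simp_rw [hL]
  rw [hS, hJ, hA, hK, Finset.prod_const, Ideal.top_pow, Ideal.top_mul, Ideal.top_mul, Ideal.mul_top,
    Ideal.mul_top]

/-- If `u = u e` for a non-zero-divisor `u` then `e = 1` (`e_i = 1` in the plain instance path). [folklore] -/
theorem eq_one_of_eq_mul_self {u e : A} (hu : u ∈ A⁰) (h : u = u * e) : e = 1 := by
  have h1 : (e - 1) * u = 0 := by
    rw [sub_mul, one_mul, mul_comm, ← h, sub_self]
  have h2 := (mem_nonZeroDivisors_iff_right.mp hu) _ h1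
  rwa [sub_eq_zero] at h2

/-- Collecting the Cartier twist of the member's chart image. [folklore] -/
theorem collect_member (u : A) (K L J A' S : Ideal A) :
    (Ideal.span {u ^ 2} * K) * ((Ideal.span {u ^ 6} * L) * (((Ideal.span {u ^ 2} * J) *
      (Ideal.span {u ^ 2} * A')) * (Ideal.span {u} * S))) =
      Ideal.span {u ^ 13} * (L * (K * (J * A') * S)) := by
  rw [← Ideal.span_singleton_pow, ← Ideal.span_singleton_pow, ← Ideal.span_singleton_pow]
  ring

end Special

/-! ## The member, its avatars, and their images on a Rees chart of `Bl_{(x)}` (any ring) -/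

section Charts

variable {R : Type u} [CommRing R] {n : ℕ} (x : Fin n → R) (iw iz i : Fin n)

/-- `M = (x)` (the maximal ideal in the application). -/
local notation3 "M" => Ideal.span (Set.range x)
/-- The member `I = (z² + w³) + M⁴`. -/
local notation3 "II" => (Ideal.span {x iz ^ 2 + x iw ^ 3} ⊔ Ideal.span (Set.range x) ^ 4)
/-- The line avatars `𝔞_{j+1} = M^{j+2} + (w^{j+1}) + z M^j`. -/
local notation3 "aL[" j "]" => (Ideal.span (Set.range x) ^ (j + 2) ⊔ Ideal.span {x iw ^ (j + 1)} ⊔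
  Ideal.span {x iz} * Ideal.span (Set.range x) ^ j)
/-- The tangency-surface avatar `𝔞_Σ = M² + (z)`. -/
local notation3 "aS" => (Ideal.span (Set.range x) ^ 2 ⊔ Ideal.span {x iz})
/-- The graded-hull avatar `J = (z²) + (w³) + M⁴`. -/
local notation3 "JJ" => (Ideal.span {x iz ^ 2} ⊔ Ideal.span {x iw ^ 3} ⊔ Ideal.span (Set.range x) ^ 4)
/-- The avatar `I + z M²`. -/
local notation3 "AA" => ((Ideal.span {x iz ^ 2 + x iw ^ 3} ⊔ Ideal.span (Set.range x) ^ 4) ⊔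
  Ideal.span {x iz} * Ideal.span (Set.range x) ^ 2)
/-- The companion `Q₀ = 𝔞₁ 𝔞₂ 𝔞₃ · (J · (I + zM²)) · 𝔞_Σ`. -/
local notation3 "Q₀" => ((∏ j ∈ Finset.range 3, aL[j]) * ((JJ * AA) * aS))
/-- The chart ring data: `u = x_i/1`, `c = z/x_i`, `a = w/x_i`. -/
local notation3 "φ" => chartBase x i
local notation3 "uu" => chartBase x i (x i)
local notation3 "cc" => chartGen x i iz
local notation3 "aa" => chartGen x i iw

/-- `Mᵏ · B_i = (uᵏ)`. [cite: StacksProject, Tag 0804] -/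
theorem map_M_pow (k : ℕ) : (M ^ k).map φ = Ideal.span {uu ^ k} := by
  rw [Ideal.map_pow, map_reesChartBase_eq (x i) (Ideal.mem_span_range_self (f := x) (x := i)),
    Ideal.span_singleton_pow]

/-- **The member on a chart**: `I · B_i = u² · ((c² + u a³) + (u²))`. [cite: StacksProject, Tag 0804] -/
theorem map_member : (II).map φ = Ideal.span {uu ^ 2} * Kf[uu,cc,aa,3] := by
  rw [Ideal.map_sup, map_span_singleton, map_M_pow, map_add, map_pow, map_pow,
    reesChartBase_apply_eq_mul_chartGen x i iz, reesChartBase_apply_eq_mul_chartGen x i iw]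
  have e1 : (uu * cc) ^ 2 + (uu * aa) ^ 3 = uu ^ 2 * (cc ^ 2 + uu * aa ^ 3) := by ring
  have e2 : uu ^ 4 = uu ^ 2 * uu ^ 2 := by ring
  rw [e1, e2, Ideal.mul_sup, Ideal.span_singleton_mul_span_singleton, Ideal.span_singleton_mul_span_singleton]

/-- A line avatar on a chart: `𝔞_{j+1} · B_i = u^{j+1} · (u, a^{j+1}, c)`. [cite: StacksProject, Tag 0804] -/
theorem map_aL (j : ℕ) : (aL[j]).map φ = Ideal.span {uu ^ (j + 1)} * Lf[uu,cc,aa,j] := by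
  rw [Ideal.map_sup, Ideal.map_sup, Ideal.map_mul, map_span_singleton, map_span_singleton, map_M_pow,
    map_M_pow, map_pow, reesChartBase_apply_eq_mul_chartGen x i iz,
    reesChartBase_apply_eq_mul_chartGen x i iw, Ideal.span_singleton_mul_span_singleton]
  have e1 : uu ^ (j + 2) = uu ^ (j + 1) * uu := by ring
  have e2 : (uu * aa) ^ (j + 1) = uu ^ (j + 1) * aa ^ (j + 1) := by ring
  have e3 : uu * cc * uu ^ j = uu ^ (j + 1) * cc := by ring
  rw [e1, e2, e3, Ideal.mul_sup, Ideal.mul_sup, Ideal.span_singleton_mul_span_singleton,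
    Ideal.span_singleton_mul_span_singleton, Ideal.span_singleton_mul_span_singleton]

/-- The tangency-surface avatar on a chart: `𝔞_Σ · B_i = u · (u, c)`. [cite: StacksProject, Tag 0804] -/
theorem map_aS : (aS).map φ = Ideal.span {uu} * Sf[uu,cc] := by
  rw [Ideal.map_sup, map_span_singleton, map_M_pow, reesChartBase_apply_eq_mul_chartGen x i iz,
    span_range_vec2, Ideal.mul_sup, Ideal.span_singleton_mul_span_singleton,
    Ideal.span_singleton_mul_span_singleton]
  have e1 : uu ^ 2 = uu * uu := by ring
  rw [e1]

/-- The graded-hull avatar on a chart: `J · B_i = u² · (c², u a³, u²)`. [cite: StacksProject, Tag 0804] -/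
theorem map_JJ : (JJ).map φ = Ideal.span {uu ^ 2} * Jf[uu,cc,aa,3] := by
  rw [Ideal.map_sup, Ideal.map_sup, map_span_singleton, map_span_singleton, map_M_pow, map_pow, map_pow,
    reesChartBase_apply_eq_mul_chartGen x i iz, reesChartBase_apply_eq_mul_chartGen x i iw]
  have e1 : (uu * cc) ^ 2 = uu ^ 2 * cc ^ 2 := by ring
  have e2 : (uu * aa) ^ 3 = uu ^ 2 * (uu * aa ^ 3) := by ring
  have e3 : uu ^ 4 = uu ^ 2 * uu ^ 2 := by ring
  rw [e1, e2, e3, Ideal.mul_sup, Ideal.mul_sup, Ideal.span_singleton_mul_span_singleton,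
    Ideal.span_singleton_mul_span_singleton, Ideal.span_singleton_mul_span_singleton]

/-- The avatar `I + zM²` on a chart: `u² · ((c² + u a³) + (u², u c))`. [cite: StacksProject, Tag 0804] -/
theorem map_AA : (AA).map φ = Ideal.span {uu ^ 2} * Af[uu,cc,aa,3] := by
  rw [Ideal.map_sup, map_member, Ideal.map_mul, map_span_singleton, map_M_pow,
    reesChartBase_apply_eq_mul_chartGen x i iz, Ideal.span_singleton_mul_span_singleton]
  have e1 : uu * cc * uu ^ 2 = uu ^ 2 * (uu * cc) := by ring
  conv_rhs => rw [Ideal.mul_sup, Ideal.span_singleton_mul_span_singleton]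
  rw [e1]

set_option maxHeartbeats 400000 in
-- instance-path defeq through `HomogeneousLocalization`'s standalone `Pow`/`Mul` (as in p508825)
/-- **THE CHART IMAGE OF `I · Q₀`** on every Rees chart `D₊(x_i t)` of `Bl_M Spec R`:
`(I Q₀) B_i = u^N · F₃(u, z/x_i, w/x_i)`, `F₃` the line-step residual of part 1.
[cite: StacksProject, Tag 0804] -/
theorem map_member_mul_Q₀ :
    (II * Q₀).map φ = Ideal.span {uu ^ 13} * Ff[uu,cc,aa,3] := by
  have hsum : (∑ j ∈ Finset.range 3, (j + 1)) = 6 := by decide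
  rw [Ideal.map_mul, Ideal.map_mul, Ideal.map_mul, Ideal.map_mul, CoreRungTower.map_prod_range,
    map_member, map_JJ, map_AA, map_aS]
  simp_rw [map_aL]
  rw [Finset.prod_mul_distrib, Ideal.prod_span_singleton, Finset.prod_pow_eq_pow_sum, hsum]
  exact collect_member _ _ _ _ _ _

/-- `Q₀ ⊇ M¹⁹`. [folklore] -/
theorem pow_le_Q₀ : M ^ 19 ≤ Q₀ := by
  have hL : M ^ 9 ≤ ∏ j ∈ Finset.range 3, aL[j] := by
    rw [Finset.prod_range_succ, Finset.prod_range_succ, Finset.prod_range_succ, Finset.prod_range_zero,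
      one_mul, show (9 : ℕ) = 2 + 3 + 4 from rfl, pow_add, pow_add]
    exact Ideal.mul_mono (Ideal.mul_mono (le_sup_of_le_left le_sup_left) (le_sup_of_le_left le_sup_left))
      (le_sup_of_le_left le_sup_left)
  have hJ : M ^ 4 ≤ JJ := le_sup_right
  have hA : M ^ 4 ≤ AA := le_sup_of_le_left le_sup_right
  have hS : M ^ 2 ≤ aS := le_sup_left
  rw [show (19 : ℕ) = 9 + ((4 + 4) + 2) from rfl, pow_add, pow_add, pow_add]
  exact Ideal.mul_mono hL (Ideal.mul_mono (Ideal.mul_mono hJ hA) hS)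

end Charts

/-! ## The member over a regular local ring -/

section LocalRung

variable {S : Type u} [CommRing S] [IsRegularLocalRing S] {n : ℕ} (x : Fin n → S)
  (hx : Ideal.span (Set.range x) = IsLocalRing.maximalIdeal S)
  (hd : (IsLocalRing.maximalIdeal S).spanFinrank = n) {iw iz : Fin n} (hwz : iw ≠ iz)

/-- The member `I = (z² + w³) + 𝔪⁴`. -/
local notation3 "II" => (Ideal.span {x iz ^ 2 + x iw ^ 3} ⊔ Ideal.span (Set.range x) ^ 4)
/-- The line avatars. -/
local notation3 "aL[" j "]" => (Ideal.span (Set.range x) ^ (j + 2) ⊔ Ideal.span {x iw ^ (j + 1)} ⊔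
  Ideal.span {x iz} * Ideal.span (Set.range x) ^ j)
/-- The tangency-surface avatar. -/
local notation3 "aS" => (Ideal.span (Set.range x) ^ 2 ⊔ Ideal.span {x iz})
/-- The graded-hull avatar. -/
local notation3 "JJ" => (Ideal.span {x iz ^ 2} ⊔ Ideal.span {x iw ^ 3} ⊔ Ideal.span (Set.range x) ^ 4)
/-- The avatar `I + z𝔪²`. -/
local notation3 "AA" => ((Ideal.span {x iz ^ 2 + x iw ^ 3} ⊔ Ideal.span (Set.range x) ^ 4) ⊔
  Ideal.span {x iz} * Ideal.span (Set.range x) ^ 2)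
/-- The companion `Q₀`. -/
local notation3 "Q₀" => ((∏ j ∈ Finset.range 3, aL[j]) * ((JJ * AA) * aS))

include hx hd hwz in
/-- **Every Rees chart of `Bl_𝔪 Spec S` blown up along `(I Q₀) · B_i` is regular** (`x_i ∉ {w, z}`:
`lineTower_isRegular 3` for `(u, z/x_i, w/x_i)`; `x_i = w`: tangent Euclid; `x_i = z`: Cartier).
[cite: Liu2002, Thm. 8.1.19 (a)] [cite: StacksProject, Tag 080A] [cite: StacksProject, Tag 0BIQ] -/
theorem isRegular_charts (i : Fin n) (Y : Scheme.{u}) (ρ : Y ⟶ Spec (.of (chartRing x i)))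
    (hρ : IsBlowup ρ (affineBlowup.idealSheaf ((II * Q₀).map (chartBase x i)))) :
    Scheme.IsRegular Y := by
  haveI : IsRegularRing S := isRegularRing_of_isRegularLocalRing S
  haveI : IsRegularRing (S ⧸ Ideal.span (Set.range x)) := by
    haveI : (Ideal.span (Set.range x)).IsMaximal := hx ▸ IsLocalRing.maximalIdeal.isMaximal S
    letI := Ideal.Quotient.field (Ideal.span (Set.range x))
    infer_instance
  have hq : IsQuasiRegular x := isQuasiRegular_regularSystemOfParameters hd x hx
  haveI hB : IsRegularRing (chartRing x i) := isRegularRing_blowupChart x i hq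
  have hu : chartBase x i (x i) ∈ (chartRing x i)⁰ :=
    reesChartBase_mem_nonZeroDivisors (x i) (Ideal.mem_span_range_self (f := x) (x := i))
  have he : chartGen x i i = 1 := eq_one_of_eq_mul_self hu (reesChartBase_apply_eq_mul_chartGen x i i)
  rw [map_member_mul_Q₀] at hρ
  refine CoreRungTower.isRegular_of_isBlowup_span_singleton_mul (pow_mem hu 13) _ (fun Y' ρ' hρ' => ?_) hρ
  by_cases hiz : i = iz
  · -- chart of `z`: `c = 1`, `F₃ = (1)`
    subst hiz
    rw [he, F_c_one, affineBlowup.idealSheaf_top] at hρ'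
    haveI : IsIso ρ' := hρ'.isIso isEffectiveCartier_top
    haveI : IsRegularRing (CommRingCat.of (chartRing x i)) := hB
    exact SectionAscent.TraceIdeal.isRegular_of_iso (asIso ρ') (Scheme.isRegular_Spec _)
  by_cases hiw : i = iw
  · -- chart of `w`: `a = 1`, tangent Euclid for the chart family `(u, c)`
    subst hiw
    rw [he, F_three_a_one] at hρ'
    let jJ : Fin 1 → {j : Fin n // j ≠ i} := fun _ => ⟨iz, fun h => hiz h.symm⟩
    have hfun : (Fin.cons (chartBase x i (x i)) fun k => chartGen x i (jJ k).1 : Fin 2 → chartRing x i) =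
        ![chartBase x i (x i), chartGen x i iz] := by
      funext k; fin_cases k <;> rfl
    have hq2 : IsQuasiRegular (![chartBase x i (x i), chartGen x i iz] : Fin 2 → chartRing x i) := by
      rw [← hfun]
      exact CoreRungTower.isQuasiRegular_chartFamily x i jJ hq (fun a b _ => Subsingleton.elim a b)
    have hR2 : IsRegularRing (chartRing x i ⧸ Ideal.span (Set.range
        (![chartBase x i (x i), chartGen x i iz] : Fin 2 → chartRing x i))) := by
      rw [← hfun]
      exact CoreRungTower.isRegularRing_quot_chartFamily x i jJ hq
    exact CoreRungTower.tangent_euclid_two_two _ _ hq2 hR2 hρ'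
  · -- chart of `x_i ∉ {w, z}`: the line tower for `(u, c, a)`
    let jJ : Fin 2 → {j : Fin n // j ≠ i} := ![⟨iz, fun h => hiz h.symm⟩, ⟨iw, fun h => hiw h.symm⟩]
    have hjJ : Function.Injective jJ := by
      intro a b hab
      fin_cases a <;> fin_cases b
      · rfl
      · exact absurd (congrArg Subtype.val hab) (fun h => hwz h.symm)
      · exact absurd (congrArg Subtype.val hab) hwz
      · rfl
    have hfun : (fun k : Fin 2 => chartGen x i (jJ k).1) = ![chartGen x i iz, chartGen x i iw] := by
      funext k; fin_cases k <;> rfl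
    have hw3 : RingTheory.Sequence.IsWeaklyRegular (chartRing x i)
        [chartBase x i (x i), chartGen x i iz, chartGen x i iw] := by
      have h := CoreRungTower.isWeaklyRegular_chartFamily x i jJ hq hjJ
      have hl : List.ofFn (Fin.cons (chartBase x i (x i)) fun k => chartGen x i (jJ k).1) =
          [chartBase x i (x i), chartGen x i iz, chartGen x i iw] := rfl
      rw [hl] at h
      exact h
    have h3 : IsRegularRing (chartRing x i ⧸ (Ideal.span {chartBase x i (x i)} ⊔
        Ideal.span {chartGen x i iz} ⊔ Ideal.span {chartGen x i iw})) := by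
      have h := CoreRungTower.isRegularRing_quot_chartFamily x i jJ hq
      rw [Fin.range_cons, hfun, Ideal.span_insert, span_range_vec2, ← sup_assoc] at h
      exact h
    have h2 : IsRegularRing (chartRing x i ⧸ (Ideal.span {chartBase x i (x i)} ⊔
        Ideal.span {chartGen x i iz})) := by
      let jJ' : Fin 1 → {j : Fin n // j ≠ i} := fun _ => ⟨iz, fun h => hiz h.symm⟩
      have h := CoreRungTower.isRegularRing_quot_chartFamily x i jJ' hq
      have hr : (fun k : Fin 1 => chartGen x i (jJ' k).1) = fun _ => chartGen x i iz := funext fun _ => rfl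
      rw [Fin.range_cons, hr, Set.range_const, Ideal.span_insert] at h
      exact h
    exact lineTower_isRegular 3 _ _ _ hw3 h3 h2 hρ'

include hx hd hwz in
/-- **The tower is regular**: every blowing up of `Spec S` along `(I · Q₀) · 𝔪` is regular. [cite: StacksProject, Tag 080A] -/
theorem isRegular_of_isBlowup_member_mul_companion {Y : Scheme.{u}} {f : Y ⟶ Spec (.of S)}
    (hf : IsBlowup f (affineBlowup.idealSheaf ((II * Q₀) * IsLocalRing.maximalIdeal S))) :
    Scheme.IsRegular Y := by
  rw [← hx] at hf
  exact isRegular_of_isBlowup_mul_of_charts x _ (isRegular_charts x hx hd hwz) hf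

include hx hd hwz in
/-- **The cusp member is in the companion class** (W2 / r1d format; companion `Q₀ · 𝔪 ⊇ 𝔪²⁰`). [cite: StacksProject, Tag 080A] -/
theorem companion_member :
    ∃ (Q : Ideal S) (m' : ℕ), IsLocalRing.maximalIdeal S ^ m' ≤ Q ∧
      ∃ (B : Scheme.{u}) (b : B ⟶ Spec (.of S)),
        IsBlowup b (affineBlowup.idealSheaf (II * Q)) ∧ Scheme.IsRegular B := by
  obtain ⟨B, b, hb⟩ := exists_isBlowup (Spec (.of S))
    (affineBlowup.idealSheaf ((II * Q₀) * IsLocalRing.maximalIdeal S))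
  refine ⟨Q₀ * IsLocalRing.maximalIdeal S, 20, ?_, B, b, by rwa [← mul_assoc],
    isRegular_of_isBlowup_member_mul_companion x hx hd hwz hb⟩
  rw [pow_succ]
  exact Ideal.mul_mono (by rw [← hx]; exact pow_le_Q₀ x iw iz) le_rfl

include hx hd hwz in
/-- **CORE RUNG (kernel (iii), the cusp member).** `S` regular local (any dimension), `w ≠ z` in a
regular system of parameters: every blowing up `T` of `Spec S` along `I = (z² + w³) + 𝔪⁴` satisfies
the conclusion of the blow-up-form open core. [cite: StacksProject, Tag 080A] [cite: GortzWedhorn2020, Prop. 13.91 (2)] -/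
theorem coreRung_member (h𝔪 : IsLocalRing.maximalIdeal S ≠ ⊥) (T : Scheme.{u}) (f : T ⟶ Spec (.of S))
    (hf : IsBlowup f (affineBlowup.idealSheaf (II))) :
    ∃ (J : T.IdealSheafData) (T' : Scheme.{u}) (π : T' ⟶ T), J ≠ ⊥ ∧
      (∀ t : T, t ∈ J.support → f.base t = IsLocalRing.closedPoint S) ∧
      IsBlowup π J ∧ Scheme.IsRegular T' := by
  have hI : II ≠ ⊥ := fun h =>
    span_sup_pow_maximalIdeal_ne_bot h𝔪 (Ideal.span {x iz ^ 2 + x iw ^ 3}) 4 (by rw [hx] at h; exact h)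
  exact atomConclusion_of_pointBlowup_charts x hx h𝔪 hI (N := 19) (by rw [← hx]; exact pow_le_Q₀ x iw iz)
    (isRegular_charts x hx hd hwz) T f hf

/-- **The registered core's binder shape (`stub_atomDimFourBlowup`), restricted to the cusp member**
`I = (z² + w³) + 𝔪⁴`, `w ≠ z` in a regular system of parameters; the dimension, characteristic,
completeness, residue-field and off-fibre hypotheses are not used (underscored).
[cite: StacksProject, Tag 080A] -/
theorem atomDimFourBlowupAt_member (p : ℕ) (_hp : p.Prime) (S : Type)
    [CommRing S] [IsRegularLocalRing S] [CharP S p]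
    [IsAdicComplete (IsLocalRing.maximalIdeal S) S]
    [PerfectField (IsLocalRing.ResidueField S)] (_hS : ringKrullDim S = (4 : ℕ))
    {n : ℕ} (x : Fin n → S) (hx : Ideal.span (Set.range x) = IsLocalRing.maximalIdeal S)
    (hd : (IsLocalRing.maximalIdeal S).spanFinrank = n) {iw iz : Fin n} (hwz : iw ≠ iz)
    (h𝔪 : IsLocalRing.maximalIdeal S ≠ ⊥)
    (T : Scheme.{0}) (f : T ⟶ Spec (.of S))
    (hf : IsBlowup f (affineBlowup.idealSheaf
      (Ideal.span {x iz ^ 2 + x iw ^ 3} ⊔ Ideal.span (Set.range x) ^ 4)))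
    (_hoff : ∀ t : T, f.base t ≠ IsLocalRing.closedPoint S →
      IsRegularLocalRing (T.presheaf.stalk t)) :
    ∃ (J : T.IdealSheafData) (T' : Scheme.{0}) (π : T' ⟶ T), J ≠ ⊥ ∧
      (∀ t : T, t ∈ J.support → f.base t = IsLocalRing.closedPoint S) ∧
      IsBlowup π J ∧ Scheme.IsRegular T' :=
  coreRung_member x hx hd hwz h𝔪 T f hf

end LocalRung

end CuspMember

end Summit.ResolutionOfSingularities.ResolutionOfSingularities.Theorems

end
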